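/-
Origin: expansion seat `planner-pub-hodgecm-1-g66-0`, handover #D1 2026-08-20T13:48Z md5 7091c3aea574 (PKG 0d0373fda07b → 7091c3aea574; 227 l.; DOC-ONLY: module docstring l.70 rider «PerL stays REFUTED [galois+K] (N19)» → the (S6) standing sentence; NAME LIST: none) (`HOME/pub-hodgecm-1-g66/lean/doc52/HodgeCM/StubTree/EndStateByName.lean`, md5 7091c3aea574, 227 lines);
landed by the second packager p2 gen 8 (p2-g8) in gate run 52 REPLACES the earlier landed copy of `HodgeCM/StubTree/EndStateByName.lean` (seat copy carried the packager Origin header of an earlier run (stripped)).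
-/
/-
Origin: planner-pub-hodgecm-prl2-g8-0 (unit pub-hodgecm-prl2-g8; EXPANSION prover a-2 "REDUCE, don't construct", generation 8).
Target: HodgeCM/StubTree/EndStateByName.lean (NEW additive leaf over this generation's `HodgeCM.StubTree.LineAlbaneseLiu` and
`HodgeCM.StubTree.SignMatchCompact`; nothing landed or queued is replaced).  WIP imports `Prl2g8.X` ↦ `HodgeCM.StubTree.X`.
-/
import Summits.HodgeConjecture.HodgeCM.StubTree.LineAlbaneseLiu
import Summits.HodgeConjecture.HodgeCM.StubTree.SignMatchCompact

/-!
# The end state of strategy 2, generation 8: `RealisationExistsPerL/Face ⇐ PRINT-by-name ∧ READINGS ∧ MODEL ∧ DESIGN`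

Generation 8, file 5 — bookkeeping only, no new mathematics.  Files 1–4 reduced the two 2001-programme inputs
`RealisationExistsPerL` / `RealisationExistsFace` (the BMM–glue package of generations 4–7) conjunct by conjunct; this
file assembles the SHARPEST package the four files support and derives the lineage's end states from it:

* KERNEL (`BMMDict.homogeneous_of_lineAlbanese`): the gen-6 reading (X2) `BMMDict.Homogeneous` ("a theta class from one
  line lies in one isotypic piece") FOLLOWS from the Albanese dictionary `BMMDict.LineAlbanese` (file 1) — `line Γ a` is
  the union of the `lineTheta Γ a Φ`, and `U_Ψ(Γ)` is a submodule (the zero class lies in every piece) — hence from the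
  Liu-literal reading `BMMDict.LineAlbaneseLiu` (file 2, `lineAlbanese_of_liu`).  So `Homogeneous` is DROPPED as an input.
* THE PACKAGE BY NAME (`BMMPrintFace` / `BMMPrintPerL`): file 4's full-sign package `BMMByNameSignFace/PerL` with
  `Homogeneous` removed and `LineAlbanese` replaced by the Liu-literal `LineAlbaneseLiu` (verbatim core [Liu21] Def. 4.5 (2)
  as `HodgeCM.Literature.Theta.LiuCMData.Def45_det`, cf-kudla-howe-rallis-g7).  Every conjunct is classified below.
* END STATES (`COR_CM_of_liu_bmmPrint`, `perL44_of_liu_bmmPrint`, `perL_of_liu_bmmPrint`, and the two junctions with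
  strategy 1's constructed theta model `AdelicThetaCore₀.thetaModel false d12 d34`).

CENSUS OF `BMMPrintPerL T` (per PerL context `(K, L, j, φ, ι₁, t, V)`; the Face form has the face binders instead):
* `U.UisoDisjoint V`, `U.UisoRigid V` — MODEL (isotypic disjointness / isogeny rigidity of the `U_Ψ(Γ)`; node 04's list and
  file 1).
* `BD.Standard T` — the dictionary seams (DEF `m_eq`, `hab`, `line_real`; P-IF `real_inj`, `h10_le`, `theta_sub`; MODEL
  `descent`), `HodgeCM.StubTree.ThetaSpanFromBMM`.
* `∀ Γ, (BD.X Γ).Cor79` — PRINT BY NAME: [BMM16] N. Bergeron, J. Millson, C. Mœglin, *Acta Math.* 216 (2016), Cor. 7.3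
  p. 66 / Thm 7.2 p. 65 (= arXiv:1306.1515 Cor 7.9 / Thm 7.8, the numbering the package's field names use; tree
  `Literature.RepresentationTheory.BergeronMillsonMoeglin2016.BMMSpectrum.Cor_7_3`, `.Thm_7_2`, degree one for `m = 3` by
  `cor_7_3_degree_one`).
* `BD.LineAlbaneseLiu` — P-IF READING around the verbatim [Liu21] Def. 4.5 (2) (Y. Liu, *J. reine angew. Math.* 2021 =
  arXiv:2102.11518v2, p. 18; Prop. 4.6 (1) existence; Thm 4.18 (2), pp. 22–23): the Albanese dictionary for line theta
  one-forms over Liu's literal CM data.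
* `BD.ThetaOfLine T`, `BD.LineOfTheta T` — DESIGN (the model reading `Θ_i(c,Γ) = line(Γ, a_i) ∩ U_{Ψ_i}(Γ)` of the
  primitive `T.Theta`).
* `BD.FrameBidegree T` — DESIGN seam (frame slot ↔ BMM bidegree `(a,b)`), file 3.
* `∃ AD : BD.ArchLineDatum, (∀ Γ, (AD.spectrum Γ).ArchSignature) ∧ AD.Reading` — PRINT BY NAME ([BMM16] p. 66, the
  archimedean-signature sentence in the proof of Thm 7.2 (arXiv Thm 7.8), typed by cf-kudla-howe-rallis-g7 as
  `HodgeCM.Literature.BMMArchSpectrum.ArchSignature`) ∧ **READING at `v₁` (NOT IN PRINT — THE OBSTRUCTION,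
  half 1)**: "the theta class of the CM line `⟨a⟩` with characters of `L`-type `Φ` is, at `v₁`, the cohomological
  `A_𝔮(λ)` of that sentence with `(a,b)` the frame bidegree".
* `∃ CD : BD.CompactLineDatum, CD.Print ∧ CD.CompactTheta ∧ CD.TypeWeight ∧ CD.FrameOrientation T` — PRINT BY NAME
  (J. Adams, *The theta correspondence over ℝ*, 2007, Prop. 6.6 for `(U(1), U(3,0))` and `(U(1), U(0,3))`, typed verbatim by
  cf-matsushima-murakami as `HodgeCM.Literature.UpUmnTheta.Adams_Prop_6_6`; tree
  `Literature.RepresentationTheory.Adams2007.UpUmnTheta.eq_vacuum_of_corr_vacuum`) ∧ **READING at the compact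
  places (NOT IN PRINT — THE OBSTRUCTION, half 2)**: "at `τ ∉ {ι₁, ῑ₁}` the line's local theta is Adams' vacuum
  correspondent" ∧ READING `TypeWeight` ("`τ ∈ Φ ⟺ σ_τ > 0`") ∧ DESIGN seam `FrameOrientation` (frame sign = Fock
  orientation off `v₁`).
Outside the package the end states carry the DAG's binders (`ModelAxioms`, M38 `Fact_cmInflation`,
`Fact_virtualCup11₂`, `LiuSupplyPerL/Face` = [Liu21] Thm 4.18 carriers + the `Dict` reading, `Fact_innerEmb`,
`Open_thetaSub`, `Open_thetaGen12`,
`Open_thetaReal34`, `Open_chars`, `Open_occ`, `Fact_hodgeRiemann20`, `IsoEmbPerL/Face`, and — for an abstract `T` — the two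
design pins `T.kappa = SignRecipe.kappa false`, `T.Design_frameSignConj`, both theorems on the adelic model).

VERDICT (the instruction's deliverable): `RealisationExistsPerL/Face ⇐ F₁ ∧ … ∧ F_k` with every `F_i` PRINT-by-name,
MODEL, DESIGN or a labelled READING; the `F_i` NOT in print are exactly the two ARCHIMEDEAN READINGS
(`ArchLineDatum.Reading`, `CompactLineDatum.CompactTheta`) — one mathematical sentence, "the theta class of the CM line is,
place by place at infinity, the local theta lift named in [BMM16] p. 66 (`v₁`) and [Adams07] Prop. 6.6 (compact `v`)",
whose print route (Rallis 1984 local–global compatibility of the global theta lift with the local Howe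
correspondences + the archimedean dictionaries) needs automorphic characters and local components that the theta MODEL
does not carry — recorded for the successor (GAPS prl2g8-O3).  PerL, QW8, N33 and every 2001-programme claim remain
NOT cited; printed PerL v5 stands UNREFUTED and UNPROVED (GAPS.md «PROVENANCE ANSWER (coordinator, 2026-08-20)», (S6)) independently of everything here.
-/

set_option autoImplicit false

noncomputable section

open NumberField

namespace HodgeCM

open Literature.AlgebraicGeometry.Motives (CMType)

namespace Universe

variable {U : Universe}

namespace BMMDict

variable {L : CMField} {ι₁ : L →+* ℂ} {V : HermSpace3 L ι₁} (BD : U.BMMDict V)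

/-! ## (A) KERNEL: homogeneity follows from the Albanese dictionary -/

/-- **KERNEL** (no print, no model fact): the gen-6 reading (X2) `Homogeneous` follows from the Albanese dictionary
`LineAlbanese` (file 1).  A class of `line Γ a = ⋃_Φ lineTheta Γ a Φ` is either zero — and the zero class lies in
every isotypic piece `U_Φ(Γ)`, a `ℂ`-submodule — or non-zero, and then `LineAlbanese` places it in the piece of the
reflex pair. -/
theorem homogeneous_of_lineAlbanese (hA : BD.LineAlbanese) : BD.Homogeneous := by
  intro Γ a θ hθ
  obtain ⟨Φ, hΦ⟩ := BD.mem_line_iff.mp hθ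
  by_cases hne : θ = 0
  · exact ⟨L, Φ, ι₁, hne ▸ Submodule.zero_mem _⟩
  · obtain ⟨N, k, Ψ', -, hU⟩ := hA Γ a Φ θ hΦ hne
    exact ⟨N, Ψ', ι₁.comp k, hU⟩

/-- **KERNEL**: homogeneity from the Liu-literal reading (file 2's `lineAlbanese_of_liu`, which consumes M2
`Fact_pull_comp`, M13 `Fact_alphaLine`, M38 `Fact_cmInflation`). -/
theorem homogeneous_of_liu (h2 : U.Fact_pull_comp) (h13 : U.Fact_alphaLine) (h38 : U.Fact_cmInflation)
    (hA : BD.LineAlbaneseLiu) : BD.Homogeneous :=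
  BD.homogeneous_of_lineAlbanese (BD.lineAlbanese_of_liu h2 h13 h38 hA)

end BMMDict

/-! ## (B) The package BY NAME — the sharpest form the generation supports -/

/-- **The BMM–glue package BY NAME, faces** (`RealisationExistsFace` reduced): file 4's `BMMByNameSignFace T` with
`Homogeneous` dropped (kernel, Part A) and `LineAlbanese` replaced by the Liu-literal reading `LineAlbaneseLiu`.
Conjunct classes: module docstring (PRINT by name: `Cor79`, `ArchSignature`, `CD.Print`; READINGS: `LineAlbaneseLiu`,
`AD.Reading`, `CD.CompactTheta`, `CD.TypeWeight`; MODEL: `UisoDisjoint`, `UisoRigid`, `Standard`'s descent; DESIGN: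
`ThetaOfLine`, `LineOfTheta`, `FrameBidegree`, `CD.FrameOrientation`). -/
def BMMPrintFace (T : U.ThetaModel) : Prop :=
  ∀ (F : CMField), IsGalois ℚ F → 6 ≤ Module.finrank ℚ F →
    ∀ (f : Face F) (ι₁ : F →+* ℂ), f.Admissible ι₁ → ∀ V : HermSpace3 F ι₁,
      U.UisoDisjoint V ∧ U.UisoRigid V ∧ ∃ BD : U.BMMDict V, BD.Standard T ∧ (∀ Γ, (BD.X Γ).Cor79) ∧
        BD.LineAlbaneseLiu ∧ BD.ThetaOfLine T ∧ BD.LineOfTheta T ∧ BD.FrameBidegree T ∧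
        (∃ AD : BD.ArchLineDatum, (∀ Γ, (AD.spectrum Γ).ArchSignature) ∧ AD.Reading) ∧
        ∃ CD : BD.CompactLineDatum, CD.Print ∧ CD.CompactTheta ∧ CD.TypeWeight ∧ CD.FrameOrientation T

/-- **The BMM–glue package BY NAME, PerL binders** (`RealisationExistsPerL` reduced): as `BMMPrintFace`. -/
def BMMPrintPerL (T : U.ThetaModel) : Prop :=
  ∀ (K L : CMField) (j : K →+* L), IsNormalClosure ℚ K L →
    Module.finrank ℚ K = 6 → (Module.finrank ℚ L = 24 ∨ Module.finrank ℚ L = 48) →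
    ∀ (φ : Fin 3 → (K →+* ℂ)), IsFrame φ →
    ∀ (ι₁ : L →+* ℂ), ι₁.comp j = φ 0 →
    ∀ (t : Fin 4 → CMType K), IsPerLTypes φ t →
    ∀ V : HermSpace3 L ι₁,
      U.UisoDisjoint V ∧ U.UisoRigid V ∧ ∃ BD : U.BMMDict V, BD.Standard T ∧ (∀ Γ, (BD.X Γ).Cor79) ∧
        BD.LineAlbaneseLiu ∧ BD.ThetaOfLine T ∧ BD.LineOfTheta T ∧ BD.FrameBidegree T ∧
        (∃ AD : BD.ArchLineDatum, (∀ Γ, (AD.spectrum Γ).ArchSignature) ∧ AD.Reading) ∧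
        ∃ CD : BD.CompactLineDatum, CD.Print ∧ CD.CompactTheta ∧ CD.TypeWeight ∧ CD.FrameOrientation T

namespace ThetaModel

variable {T : U.ThetaModel}

/-- KERNEL: the by-name package implies file 4's full-sign package (faces), given M2, M13, M38. -/
theorem bmmByNameSignFace_of_print (h2 : U.Fact_pull_comp) (h13 : U.Fact_alphaLine) (h38 : U.Fact_cmInflation)
    (hX : U.BMMPrintFace T) : U.BMMByNameSignFace T := by
  intro F hG hdeg f ι₁ hadm V
  obtain ⟨hI, hR, BD, hBD, hB, hA, hTL, hLT, hF, hAD, hCD⟩ := hX F hG hdeg f ι₁ hadm V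
  exact ⟨hI, hR, BD, hBD, hB, BD.homogeneous_of_liu h2 h13 h38 hA, BD.lineAlbanese_of_liu h2 h13 h38 hA,
    hTL, hLT, hF, hAD, hCD⟩

/-- KERNEL: the by-name package implies file 4's full-sign package (PerL binders), given M2, M13, M38. -/
theorem bmmByNameSignPerL_of_print (h2 : U.Fact_pull_comp) (h13 : U.Fact_alphaLine) (h38 : U.Fact_cmInflation)
    (hX : U.BMMPrintPerL T) : U.BMMByNameSignPerL T := by
  intro K L j hN hK hL φ hφ ι₁ hι₁ t ht V
  obtain ⟨hI, hR, BD, hBD, hB, hA, hTL, hLT, hF, hAD, hCD⟩ := hX K L j hN hK hL φ hφ ι₁ hι₁ t ht V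
  exact ⟨hI, hR, BD, hBD, hB, BD.homogeneous_of_liu h2 h13 h38 hA, BD.lineAlbanese_of_liu h2 h13 h38 hA,
    hTL, hLT, hF, hAD, hCD⟩

end ThetaModel

/-! ## (C) The end states of the lineage, generation 8 -/

variable (U)

/-- **COR-CM — the lineage's end state, generation 8, final form**: `HC_CM` from the DAG's binders, the by-name package
`BMMPrintFace T` (`RealisationExistsFace` reduced: PRINT by name ∧ READINGS ∧ MODEL ∧ DESIGN, census in the module
docstring), `PohlmannSpan` and `Qw8Sufficiency`. -/
theorem COR_CM_of_liu_bmmPrint (M : U.ModelAxioms) (h38 : U.Fact_cmInflation) (hV : U.Fact_virtualCup11₂)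
    (hL : U.LiuSupplyFace) {T : U.ThetaModel} (h₂ : T.Fact_innerEmb) (h₅ : T.Open_thetaSub)
    (h₇ : T.Open_thetaGen12) (h₈ : T.Open_thetaReal34) (h₉ : T.Open_chars) (h₁₀ : T.Open_occ)
    (hHR : U.Fact_hodgeRiemann20) (hk : T.kappa = SignRecipe.kappa false) (hs : T.Design_frameSignConj)
    {Hk : U.HeckeData} (hD : U.IsoEmbFace Hk T) (hX : U.BMMPrintFace T)
    (hPo : U.PohlmannSpan) (hQ : U.Qw8Sufficiency) : U.HC_CM :=
  U.COR_CM_of_liu_bmmByNameSign M hV hL h₂ h₅ h₇ h₈ h₉ h₁₀ hHR hk hs hD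
    (ThetaModel.bmmByNameSignFace_of_print M.pull_comp M.alphaLine h38 hX) hPo hQ

/-- **PerL v5 Thm 4.4 — end state, generation 8, final form.** -/
theorem perL44_of_liu_bmmPrint (M : U.ModelAxioms) (h38 : U.Fact_cmInflation) (hV : U.Fact_virtualCup11₂)
    (hL : U.LiuSupplyPerL) {T : U.ThetaModel} (h₂ : T.Fact_innerEmb) (h₅ : T.Open_thetaSub)
    (h₇ : T.Open_thetaGen12) (h₈ : T.Open_thetaReal34) (h₉ : T.Open_chars) (h₁₀ : T.Open_occ)
    (hHR : U.Fact_hodgeRiemann20) (hk : T.kappa = SignRecipe.kappa false) (hs : T.Design_frameSignConj)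
    {Hk : U.HeckeData} (hD : U.IsoEmbPerL Hk T) (hX : U.BMMPrintPerL T) : U.PerL44 :=
  U.perL44_of_liu_bmmByNameSign M hV hL h₂ h₅ h₇ h₈ h₉ h₁₀ hHR hk hs hD
    (ThetaModel.bmmByNameSignPerL_of_print M.pull_comp M.alphaLine h38 hX)

/-- **PerL (`W_per^L`) — end state, generation 8, final form** (`RealisationExistsPerL` reduced). -/
theorem perL_of_liu_bmmPrint (M : U.ModelAxioms) (h38 : U.Fact_cmInflation) (hV : U.Fact_virtualCup11₂)
    (hL : U.LiuSupplyPerL) {T : U.ThetaModel} (h₂ : T.Fact_innerEmb) (h₅ : T.Open_thetaSub)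
    (h₇ : T.Open_thetaGen12) (h₈ : T.Open_thetaReal34) (h₉ : T.Open_chars) (h₁₀ : T.Open_occ)
    (hHR : U.Fact_hodgeRiemann20) (hk : T.kappa = SignRecipe.kappa false) (hs : T.Design_frameSignConj)
    {Hk : U.HeckeData} (hD : U.IsoEmbPerL Hk T) (hX : U.BMMPrintPerL T) : U.PerL :=
  U.perL_of_liu_bmmByNameSign M hV hL h₂ h₅ h₇ h₈ h₉ h₁₀ hHR hk hs hD
    (ThetaModel.bmmByNameSignPerL_of_print M.pull_comp M.alphaLine h38 hX)

/-! ### Junction with strategy 1 (prl1): the constructed theta model at the frame bit `h = false` -/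

/-- **COR-CM over strategy 1's constructed theta model `C.thetaModel false d12 d34`, final by-name route**: both design
pins are theorems (`AdelicThetaCore₀.thetaModel_kappa`, `.design_frameSignConj`). -/
theorem COR_CM_of_liu_bmmPrint_adelic (M : U.ModelAxioms) (h38 : U.Fact_cmInflation)
    (hV : U.Fact_virtualCup11₂) (hL : U.LiuSupplyFace)
    (C : U.AdelicThetaCore₀) (d12 d34 : ∀ {L : CMField}, SeesawCtx L → SideData L)
    (h₂ : (C.thetaModel false d12 d34).Fact_innerEmb) (h₅ : (C.thetaModel false d12 d34).Open_thetaSub)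
    (h₇ : (C.thetaModel false d12 d34).Open_thetaGen12) (h₈ : (C.thetaModel false d12 d34).Open_thetaReal34)
    (h₉ : (C.thetaModel false d12 d34).Open_chars) (h₁₀ : (C.thetaModel false d12 d34).Open_occ)
    (hHR : U.Fact_hodgeRiemann20) {Hk : U.HeckeData} (hD : U.IsoEmbFace Hk (C.thetaModel false d12 d34))
    (hX : U.BMMPrintFace (C.thetaModel false d12 d34)) (hPo : U.PohlmannSpan) (hQ : U.Qw8Sufficiency) :
    U.HC_CM :=
  U.COR_CM_of_liu_bmmPrint M h38 hV hL h₂ h₅ h₇ h₈ h₉ h₁₀ hHR (C.thetaModel_kappa false d12 d34)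
    (C.design_frameSignConj false d12 d34) hD hX hPo hQ

/-- **PerL over strategy 1's constructed theta model `C.thetaModel false d12 d34`, final by-name route.** -/
theorem perL_of_liu_bmmPrint_adelic (M : U.ModelAxioms) (h38 : U.Fact_cmInflation)
    (hV : U.Fact_virtualCup11₂) (hL : U.LiuSupplyPerL)
    (C : U.AdelicThetaCore₀) (d12 d34 : ∀ {L : CMField}, SeesawCtx L → SideData L)
    (h₂ : (C.thetaModel false d12 d34).Fact_innerEmb) (h₅ : (C.thetaModel false d12 d34).Open_thetaSub)
    (h₇ : (C.thetaModel false d12 d34).Open_thetaGen12) (h₈ : (C.thetaModel false d12 d34).Open_thetaReal34)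
    (h₉ : (C.thetaModel false d12 d34).Open_chars) (h₁₀ : (C.thetaModel false d12 d34).Open_occ)
    (hHR : U.Fact_hodgeRiemann20) {Hk : U.HeckeData} (hD : U.IsoEmbPerL Hk (C.thetaModel false d12 d34))
    (hX : U.BMMPrintPerL (C.thetaModel false d12 d34)) : U.PerL :=
  U.perL_of_liu_bmmPrint M h38 hV hL h₂ h₅ h₇ h₈ h₉ h₁₀ hHR (C.thetaModel_kappa false d12 d34)
    (C.design_frameSignConj false d12 d34) hD hX

end Universe

end HodgeCM
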